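import Summits.CriticalPhenomena.CardyFormulaZ2.Theorems.CardyBoundaryCoulombGasBoundaryDefectGaussianRStubTransportPathsPart9
import Summits.CriticalPhenomena.CardyFormulaZ2.Theorems.CardyBoundaryCoulombGasBoundaryDefectGaussianRStubTransportPathsPart3
import Literature.Probability.RandomPlanarGeometry.JordanBoundaryLemmas
import HarnessLib

/-!
# Stub `stub_boundaryFeet` of line `excursion-kernel-covariance` — Part 2:
# feet of exterior darts and uniform oriented wedges (crux `RectilinearCardy`,
# stmt-CriticalPhenomena-5660)

* The FOOT of a dart `d = (v, k)` of the closure lattice polygon `V_δ = {v : δ v ∈ closure D}`: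
  the last point of `closure D` on the mesh segment from `δ v` straight ahead in direction `k`,
  `bftPhi D δ d = δ v + s* · i^k` with `s* = bftFoot D δ d ∈ [0, δ]` (`bft_foot_spec`); for an
  exterior dart `s* < δ` (`bft_foot_lt`) and the foot is a frontier point (`bft_phi_frontier`),
  hence `γ (bftPar D δ d)` for a unique parameter `bftPar D δ d ∈ [0, 1)` (`bft_par_spec`);
  `bft_boundary_add_int` — one lap of the loop;
* `bft_uniform_wedge` — the oriented wedges of `tp_wedgeAt_oriented` at the points of a finite
  subcover: ONE radius `r₀ > 0` such that the closed `r₀`-disc about any frontier point lies in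
  the disc of an oriented wedge (straight monotone pieces of `γ` on both sides of the apex,
  frontier chart and domain chart).
All [folklore].
-/

noncomputable section

open Set Filter Metric Topology
open Literature.Probability.RandomPlanarGeometry
open Literature.Probability.LatticeModels Literature.Probability.LatticeModels.CollarLegModel
open Summit.CriticalPhenomena.CardyFormulaZ2.Cruxes.BoundaryDefectGaussianR.RainbowMonomialsInExcursionKernels

namespace Summit.CriticalPhenomena.CardyFormulaZ2.Cruxes.RectilinearCardy.ExcursionKernelCovariance

/-! ### Mesh points and lattice directions as complex numbers -/

/-- The mesh point `δ v` of a lattice point. [folklore] -/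
def bftMesh (δ : ℝ) (v : ℤ × ℤ) : ℂ := (v.1 : ℂ) * (δ : ℂ) + (v.2 : ℂ) * (δ : ℂ) * Complex.I

/-- The lattice direction `dir k` as a complex unit. [folklore] -/
def bftDirC (k : Fin 4) : ℂ := ((dir k).1 : ℂ) + ((dir k).2 : ℂ) * Complex.I

/-- `dir k` read as a complex number is `i^k`. [folklore] -/
theorem bft_dirC_eq_pow (k : Fin 4) : bftDirC k = Complex.I ^ (k : ℕ) := by
  fin_cases k <;> simp [bftDirC, tp_dir_val, pow_succ]

/-- The complex lattice directions are units. [folklore] -/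
theorem bft_norm_dirC (k : Fin 4) : ‖bftDirC k‖ = 1 := by
  rw [bft_dirC_eq_pow, norm_pow, Complex.norm_I, one_pow]

/-- Mesh points of neighbours: `δ (v + dir k) = δ v + δ i^k`. [folklore] -/
theorem bft_mesh_add_dir (δ : ℝ) (v : ℤ × ℤ) (k : Fin 4) :
    bftMesh δ (v + dir k) = bftMesh δ v + (δ : ℂ) * bftDirC k := by
  simp only [bftMesh, bftDirC, Prod.fst_add, Prod.snd_add, Int.cast_add]
  ring

/-- Distance of two points on a mesh segment. [folklore] -/
theorem bft_dist_on_segment (δ : ℝ) (v : ℤ × ℤ) (k : Fin 4) (s s' : ℝ) :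
    dist (bftMesh δ v + (s : ℂ) * bftDirC k) (bftMesh δ v + (s' : ℂ) * bftDirC k) = |s - s'| := by
  rw [dist_eq_norm, show bftMesh δ v + (s : ℂ) * bftDirC k - (bftMesh δ v + (s' : ℂ) * bftDirC k) =
    ((s - s' : ℝ) : ℂ) * bftDirC k by push_cast; ring, norm_mul, bft_norm_dirC, mul_one,
    Complex.norm_real, Real.norm_eq_abs]

/-! ### The foot of a dart -/

/-- The foot abscissa of the dart `d`: the largest `s ∈ [0, δ]` with `δ d.1 + s i^(d.2)` in the
closure of the domain. [folklore] -/
def bftFoot (D : JordanDomain) (δ : ℝ) (d : Dart) : ℝ :=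
  sSup {s : ℝ | s ∈ Icc (0 : ℝ) δ ∧ bftMesh δ d.1 + (s : ℂ) * bftDirC d.2 ∈ closure D.carrier}

/-- The foot of the dart `d`: the last point of the closure on the mesh segment of `d`.
[folklore] -/
def bftPhi (D : JordanDomain) (δ : ℝ) (d : Dart) : ℂ :=
  bftMesh δ d.1 + ((bftFoot D δ d : ℝ) : ℂ) * bftDirC d.2

open Classical in
/-- The boundary parameter in `[0, 1)` of the foot of `d` (`0` if the foot is not a frontier
point). [folklore] -/
def bftPar (D : JordanDomain) (δ : ℝ) (d : Dart) : ℝ :=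
  if h : ∃ t, t ∈ Ico (0 : ℝ) 1 ∧ D.boundary t = bftPhi D δ d then Classical.choose h else 0

/-- **The foot abscissa is attained.** If `δ d.1 ∈ closure D` then `s* = bftFoot D δ d ∈ [0, δ]`,
the foot lies in the closure, and no point of the segment beyond it does. [folklore] -/
theorem bft_foot_spec (D : JordanDomain) {δ : ℝ} (hδ : 0 ≤ δ) (d : Dart)
    (hv : bftMesh δ d.1 ∈ closure D.carrier) :
    bftFoot D δ d ∈ Icc (0 : ℝ) δ ∧ bftPhi D δ d ∈ closure D.carrier ∧
      ∀ s, bftFoot D δ d < s → s ≤ δ → bftMesh δ d.1 + (s : ℂ) * bftDirC d.2 ∉ closure D.carrier := by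
  set S := {s : ℝ | s ∈ Icc (0 : ℝ) δ ∧ bftMesh δ d.1 + (s : ℂ) * bftDirC d.2 ∈ closure D.carrier}
    with hS
  have h0 : (0 : ℝ) ∈ S := ⟨⟨le_rfl, hδ⟩, by simpa using hv⟩
  have hne : S.Nonempty := ⟨0, h0⟩
  have hbdd : BddAbove S := ⟨δ, fun s hs => hs.1.2⟩
  have hclosed : IsClosed S := by
    have hc : Continuous fun s : ℝ => bftMesh δ d.1 + (s : ℂ) * bftDirC d.2 := by fun_prop
    exact isClosed_Icc.inter (isClosed_closure.preimage hc)
  have hmem : sSup S ∈ S := hclosed.csSup_mem hne hbdd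
  have hfoot : bftFoot D δ d = sSup S := rfl
  refine ⟨hfoot ▸ hmem.1, ?_, fun s hs hsδ hin => ?_⟩
  · rw [bftPhi, hfoot]; exact hmem.2
  · have hsS : s ∈ S := ⟨⟨hmem.1.1.trans (hfoot ▸ hs).le, hsδ⟩, hin⟩
    have := le_csSup hbdd hsS
    rw [← hfoot] at this
    linarith

/-- The foot abscissa from an explicit description of the closure along the segment. [folklore] -/
theorem bft_foot_eq (D : JordanDomain) {δ : ℝ} (d : Dart) {s₁ : ℝ} (h0 : 0 ≤ s₁) (h1 : s₁ ≤ δ)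
    (h : ∀ s ∈ Icc (0 : ℝ) δ, bftMesh δ d.1 + (s : ℂ) * bftDirC d.2 ∈ closure D.carrier ↔ s ≤ s₁) :
    bftFoot D δ d = s₁ := by
  have hS : {s : ℝ | s ∈ Icc (0 : ℝ) δ ∧ bftMesh δ d.1 + (s : ℂ) * bftDirC d.2 ∈ closure D.carrier} =
      Icc 0 s₁ := by
    ext s
    simp only [mem_setOf_eq, mem_Icc]
    constructor
    · rintro ⟨hs, hin⟩; exact ⟨hs.1, (h s hs).1 hin⟩
    · rintro ⟨hs0, hs1⟩; exact ⟨⟨hs0, hs1.trans h1⟩, (h s ⟨hs0, hs1.trans h1⟩).2 hs1⟩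
  rw [bftFoot, hS, csSup_Icc h0]

/-- **The foot abscissa of an exterior dart is `< δ`.** [folklore] -/
theorem bft_foot_lt (D : JordanDomain) {δ : ℝ} (hδ : 0 ≤ δ) (d : Dart)
    (hv : bftMesh δ d.1 ∈ closure D.carrier) (htip : bftMesh δ (dartTip d) ∉ closure D.carrier) :
    bftFoot D δ d < δ := by
  obtain ⟨hI, hphi, -⟩ := bft_foot_spec D hδ d hv
  rcases hI.2.lt_or_eq with h | h
  · exact h
  · exfalso
    refine htip ?_
    rw [dartTip, bft_mesh_add_dir]
    rw [bftPhi, h] at hphi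
    exact hphi

/-- The foot is within `s* ≤ δ` of the mesh point of the dart. [folklore] -/
theorem bft_dist_phi_mesh (D : JordanDomain) {δ : ℝ} (hδ : 0 ≤ δ) (d : Dart)
    (hv : bftMesh δ d.1 ∈ closure D.carrier) :
    dist (bftPhi D δ d) (bftMesh δ d.1) = bftFoot D δ d ∧ dist (bftPhi D δ d) (bftMesh δ d.1) ≤ δ := by
  obtain ⟨hI, -, -⟩ := bft_foot_spec D hδ d hv
  have e : dist (bftPhi D δ d) (bftMesh δ d.1) = bftFoot D δ d := by
    have := bft_dist_on_segment δ d.1 d.2 (bftFoot D δ d) 0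
    simp only [Complex.ofReal_zero, zero_mul, add_zero, sub_zero] at this
    rw [bftPhi, this, abs_of_nonneg hI.1]
  exact ⟨e, e ▸ hI.2⟩

/-- **The foot of an exterior dart is a frontier point.** [folklore] -/
theorem bft_phi_frontier (D : JordanDomain) {δ : ℝ} (hδ : 0 ≤ δ) (d : Dart)
    (hv : bftMesh δ d.1 ∈ closure D.carrier) (htip : bftMesh δ (dartTip d) ∉ closure D.carrier) :
    bftPhi D δ d ∈ frontier D.carrier := by
  obtain ⟨hI, hphi, hbeyond⟩ := bft_foot_spec D hδ d hv
  have hlt := bft_foot_lt D hδ d hv htip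
  rw [D.isOpen.frontier_eq]
  refine ⟨hphi, fun hin => ?_⟩
  obtain ⟨ε, hε, hball⟩ := Metric.isOpen_iff.1 D.isOpen _ hin
  set s := min δ (bftFoot D δ d + ε / 2) with hs
  have hs1 : bftFoot D δ d < s := lt_min hlt (by linarith)
  have hs2 : s ≤ δ := min_le_left _ _
  refine hbeyond s hs1 hs2 (subset_closure (hball ?_))
  rw [mem_ball, bftPhi, bft_dist_on_segment, abs_of_pos (by linarith)]
  have : s ≤ bftFoot D δ d + ε / 2 := min_le_right _ _
  linarith

/-- **The parameter of the foot.** If the foot is a frontier point then `bftPar D δ d ∈ [0, 1)`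
and `γ (bftPar D δ d)` is the foot. [folklore] -/
theorem bft_par_spec (D : JordanDomain) {δ : ℝ} (d : Dart)
    (h : bftPhi D δ d ∈ frontier D.carrier) :
    bftPar D δ d ∈ Ico (0 : ℝ) 1 ∧ D.boundary (bftPar D δ d) = bftPhi D δ d := by
  rw [D.frontier_eq_image_Ico] at h
  obtain ⟨t, ht, hte⟩ := h
  have hex : ∃ t, t ∈ Ico (0 : ℝ) 1 ∧ D.boundary t = bftPhi D δ d := ⟨t, ht, hte⟩
  have e : bftPar D δ d = Classical.choose hex := by
    rw [bftPar, dif_pos hex]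
  rw [e]
  exact Classical.choose_spec hex

/-- **Any parameter of the foot is the chosen one up to an integer.** [folklore] -/
theorem bft_par_of_eq (D : JordanDomain) {δ : ℝ} (d : Dart)
    (h : bftPhi D δ d ∈ frontier D.carrier) {u : ℝ} (hu : D.boundary u = bftPhi D δ d) :
    ∃ j : ℤ, bftPar D δ d = u + j := by
  obtain ⟨hmem, heq⟩ := bft_par_spec D d h
  refine ⟨-⌊u⌋, ?_⟩
  have hu' : D.boundary (u - ⌊u⌋) = D.boundary u := by
    have := D.periodic_boundary.sub_int_mul_eq ⌊u⌋ (x := u)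
    rwa [mul_one] at this
  have h1 : u - ⌊u⌋ ∈ Ico (0 : ℝ) 1 := by
    rw [Int.self_sub_floor]; exact ⟨Int.fract_nonneg u, Int.fract_lt_one u⟩
  have := D.injOn_boundary hmem h1 (by rw [heq, hu', hu])
  rw [this]; push_cast; ring

/-- One lap of the boundary loop: `γ (x + k) = γ x` for an integer `k`. [folklore] -/
theorem bft_boundary_add_int (D : JordanDomain) (x : ℝ) (k : ℤ) :
    D.boundary (x + k) = D.boundary x := by
  have := D.periodic_boundary.int_mul k x
  rwa [mul_one] at this

/-! ### Uniform oriented wedges -/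

/-- **Uniform oriented wedges.** For a Jordan domain with rectilinear frontier satisfying the
orientation clause at one parameter, there is ONE radius `r₀ > 0` such that the closed `r₀`-disc
about any frontier point lies in the disc of an oriented wedge of `tp_wedgeAt_oriented`: apex
`γ t₀`, straight strictly monotone pieces of `γ` on `[t₀, t₀ + η]` (direction `i^a`) and on
`[t₀ - η, t₀]` (direction `i^(a+m)`) reaching out of the disc, frontier chart and domain chart
(the standard sector of `m ∈ {1, 2, 3}` quadrants). [folklore] -/
theorem bft_uniform_wedge (D : JordanDomain) {S : Finset (ℂ × ℂ)}
    (hS : ∀ q ∈ S, q.1.re = q.2.re ∨ q.1.im = q.2.im)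
    (hcov : frontier D.carrier ⊆ ⋃ q ∈ S, segment ℝ q.1 q.2) {t₁ : ℝ}
    (hor : (∃ τ : ℂ, ‖τ‖ = 1 ∧
      (∃ ε : ℝ, 0 < ε ∧ ∀ t ∈ Ioo t₁ (t₁ + ε), ∃ s : ℝ, 0 < s ∧
        D.boundary t = D.boundary t₁ + (s : ℂ) * τ) ∧
      (∃ ε : ℝ, 0 < ε ∧ ∀ s ∈ Ioo (0 : ℝ) ε,
        D.boundary t₁ + (s : ℂ) * (τ * Complex.I) ∈ D.carrier))) :
    ∃ r₀ : ℝ, 0 < r₀ ∧ ∀ ζ ∈ frontier D.carrier, ∃ (t₀ r η : ℝ) (a m : ℕ),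
      0 < r ∧ 0 < η ∧ η ≤ 1 / 4 ∧ a < 4 ∧ (m = 1 ∨ m = 2 ∨ m = 3) ∧
      (∀ t ∈ Icc t₀ (t₀ + η), D.boundary t =
        D.boundary t₀ + ((‖D.boundary t - D.boundary t₀‖ : ℝ) : ℂ) * Complex.I ^ a) ∧
      StrictMonoOn (fun t => ‖D.boundary t - D.boundary t₀‖) (Icc t₀ (t₀ + η)) ∧
      r < ‖D.boundary (t₀ + η) - D.boundary t₀‖ ∧
      (∀ t ∈ Icc (t₀ - η) t₀, D.boundary t =
        D.boundary t₀ + ((‖D.boundary t - D.boundary t₀‖ : ℝ) : ℂ) * Complex.I ^ (a + m)) ∧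
      StrictAntiOn (fun t => ‖D.boundary t - D.boundary t₀‖) (Icc (t₀ - η) t₀) ∧
      r < ‖D.boundary (t₀ - η) - D.boundary t₀‖ ∧
      (∀ z, dist z (D.boundary t₀) < r → (z ∈ frontier D.carrier ↔
        (((z - D.boundary t₀) * (-Complex.I) ^ a).im = 0 ∧
            0 ≤ ((z - D.boundary t₀) * (-Complex.I) ^ a).re) ∨
          (((z - D.boundary t₀) * (-Complex.I) ^ (a + m)).im = 0 ∧
            0 ≤ ((z - D.boundary t₀) * (-Complex.I) ^ (a + m)).re))) ∧
      (∀ z, dist z (D.boundary t₀) < r → (z ∈ D.carrier ↔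
          (m = 1 → 0 < ((z - D.boundary t₀) * (-Complex.I) ^ a).re ∧
              0 < ((z - D.boundary t₀) * (-Complex.I) ^ a).im) ∧
            (m = 2 → 0 < ((z - D.boundary t₀) * (-Complex.I) ^ a).im) ∧
            (m = 3 → 0 < ((z - D.boundary t₀) * (-Complex.I) ^ a).im ∨
              ((z - D.boundary t₀) * (-Complex.I) ^ a).re < 0))) ∧
      (∀ z, dist z ζ ≤ r₀ → dist z (D.boundary t₀) < r) := by
  choose r η a m hr hη hη4 ha4 hm hdirA hmonoA hrA hdirB hantiB hrB _hloc hfront hdom using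
    fun t₀ : ℝ => tp_wedgeAt_oriented D hS hcov hor t₀
  obtain ⟨T, hT⟩ := D.isCompact_frontier.elim_finite_subcover
    (fun t : ℝ => ball (D.boundary t) (r t / 2)) (fun _ => isOpen_ball) (by
      intro ζ hζ
      rw [← D.range_boundary] at hζ
      obtain ⟨t, rfl⟩ := hζ
      exact mem_iUnion.2 ⟨t, mem_ball_self (by linarith [hr t])⟩)
  set s : Finset ℝ := insert 1 (T.image fun t => r t / 2) with hs
  have hsne : s.Nonempty := Finset.insert_nonempty _ _
  refine ⟨s.min' hsne, ?_, ?_⟩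
  · refine (Finset.lt_min'_iff s hsne).2 fun y hy => ?_
    rcases Finset.mem_insert.1 hy with rfl | hy
    · exact one_pos
    · obtain ⟨t, -, rfl⟩ := Finset.mem_image.1 hy
      linarith [hr t]
  · intro ζ hζ
    obtain ⟨t, htT, hζt⟩ := mem_iUnion₂.1 (hT hζ)
    have hmin : s.min' hsne ≤ r t / 2 :=
      Finset.min'_le s _ (Finset.mem_insert_of_mem (Finset.mem_image_of_mem _ htT))
    refine ⟨t, r t, η t, a t, m t, hr t, hη t, hη4 t, ha4 t, hm t, hdirA t, hmonoA t, hrA t,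
      hdirB t, hantiB t, hrB t, hfront t, hdom t, fun z hz => ?_⟩
    have h1 : dist ζ (D.boundary t) < r t / 2 := mem_ball.1 hζt
    linarith [dist_triangle z ζ (D.boundary t)]

end Summit.CriticalPhenomena.CardyFormulaZ2.Cruxes.RectilinearCardy.ExcursionKernelCovariance

end
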